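import Summits.BirchSwinnertonDyer.BirchSwinnertonDyer.Theorems.EisensteinPrimesBSDpOnCellCTelescopeK2WeightTwoControlMapOfMult
import HarnessLib

/-!
# Crux 4 `BSDpOnCellC` (stmt-BirchSwinnertonDyer-19034), line `telescope`, leaf N2′ / sub-leaf W2: THE `S₀`-RESIDUAL BY NAME —
# W2's control map with `S₀` ARBITRARY, the input at a ramified `w ∤ N·p` being ONE per-prime finiteness clause (fin_w)
# «`A₂^{I_w}/X·A₂^{I_w}` is killed by a power of `p`» (helper, `--supports stmt-BirchSwinnertonDyer-19034 --as helper`; closes nothing)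

Cell `bsd-eis`, width seat `bsd-line-x2-p2` (prover g21, 2026-08-30; D-0154 KEY row 5). THEOREMS ONLY: no definition, no named fact,
no `sorry`, no instance, no notation. Answer, in the kernel, to host g36's BY-NAME QUESTION (STATUS 2026-08-30T02:32:37Z) on the
`S₀`-clause of W2: the registered texts N1/N2′ (telescope v10) type the ramification of the branch lattice as `∃ S₀ finite,
IsUnramifiedOutside S₀ ρ₂` with `S₀` UNRELATED to `N`, while every landed W2 theorem (p749092, p752662, p756867, the LEAD's p757458-chain)
carries «`S₀ ∖ {w ∣ p} ⊆ {w ∣ N}`» (or (inert)). This file REMOVES that clause and isolates the true residual as a per-prime hypothesis: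

* at a ramified `w ∈ S₀` with `w ∤ p` that divides `N` (Heegner ⇒ split in `K` ⇒ finitely decomposed in `K_∞`, Brink) the cokernel of
  the weight-two control is killed by the Frobenius-data scalar `P_w((1+T)^{N_w})` exactly as in p756867 (annihilating polynomial from
  p755753, `κ(d₀ w) = p^{s_w}` from p752662's `exists_localMap_inl_toAdd_eq_pow`);
* at every OTHER ramified `w ∤ p` (in particular at an INERT prime, completely split in `K_∞`, where no Frobenius data can help because
  `κ(Γ_{K_w}) = 0`) the input is **(fin_w)**: `∃ n, ∀ a ∈ A₂^{I_w}, ∃ a₀ ∈ A₂^{I_w}, X·a₀ = p^n·a` — the inertia defect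
  `A₂^{I_w}/X·A₂^{I_w}` is killed by `p^n`; it is fed to this base's p751755
  `TelescopeK2ControlOfFrobeniusData.exists_quotSMulTop_XBig_linearMap_of_frobeniusData` as the DEGENERATE Frobenius datum
  `(d₀ w, N w, P w) = (1, 0, C(p^n))` (`κ(1) = 0 = N w`, `P(ρ₂ 1) = p^n`), whose factor in the control scalar is the constant `p^n`.

Theorems:
* §1 `not_C_dvd_C_mul_prod_of_map_ne_zero` — (hnd) generically for ARBITRARY factors non-zero after reduction along `π : 𝒪 → k`
  (p752662's `not_C_dvd_C_mul_prod_aeval` had all factors `P_i((1+T)^{N_i})`, `N_i ≥ 1`, `P_i` monic); `map_aeval_one_add_X_pow_ne_zero`,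
  `map_C_ne_zero` discharge it for the two kinds of factors.
* §2 **`exists_weightTwoControlMap_of_mult_of_finiteDefect`** — `K` imaginary quadratic, `p ≠ 2`, `κ` anticyclotomic, `𝔭bar ∋ p` of
  degree one, `E = W/ℚ` MULTIPLICATIVE at `p`, `ρ₂` with (tor)/(cof₀)/(unr `S₀`)/(fd₀ `θ₀`, finite kernel), and at every `w ∈ S₀`, `w ∤ p`:
  (deg₁)_w OR (fin_w). Conclusion: W2's `∃ α : X^∅_𝔭bar/(C X) →ₗ Sel(M₂[C X])^∨` (kernel killed prime to `C X`, finite cokernel).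
* §2 **`exists_weightTwoControlMap_of_finiteDefect`** — the Heegner-FREE twin: (fin_w) at EVERY ramified `w ∤ p`; no (deg₁), no
  annihilating polynomial, the control scalar is a power of `p`.
* §3 **`exists_weightTwoControlMap_of_cellC_of_finiteDefect`** — the road-prefix currency of the N2 workfile
  (`K2Weight2.stub_weightTwoControlMap`): `CellC W p`, `IsImaginaryQuadratic K`, `SatisfiesHeegnerHypothesis N K`, `p` split in `K`,
  `S₀ : Set` finite ARBITRARY, and (fin_w) demanded ONLY at `w ∈ S₀` with `p ∉ w` and `N ∉ w`. With `S₀ ∖ {w ∣ p} ⊆ {w ∣ N}` this is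
  p756867's `exists_weightTwoControlMap_of_cellC` (the (fin) hypothesis is then vacuous); in general it NAMES the residual of road (b).

WHY (fin_w) AND NOT «`ρ₂` unramified at `w ∤ Np`» (road (a) of the host's question): the fibre data FD of N1 constrain `ρ₂` only through
the fibres `A₂[X]`, `A₂[X − x_k]` up to finite error; a Galois-stable summand of `A₂` that is FINITE in every displayed fibre (for
instance `E′[p^∞]` for another elliptic curve `E′/K`, with `X` acting as a constant `c ∈ pℤ_p ∖ ({0} ∪ {x_k})`) satisfies (tor)/(cof)/(fd)
and ramifies wherever `E′` does — so unramifiedness outside `Np` is NOT a consequence of FD as typed, whereas the finiteness (fin_w) of the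
inertia defect is what the control argument consumes and what a generic-fibre-rank argument yields from FD + «`x` takes infinitely many
values» (seat memo ROAD-A-PRICING-x2p2g21.md). For the genuine Hida branch lattice (unramified outside `Np`) (fin_w) is vacuous off `Np`.

HONEST FRAMING: assembly over binders; the branch lattice `ρ₂` is a binder; nothing about any curve's BSD is proved;
no registered stub, crux or summit statement is proved by this file; closes: none.

References: [JetchevSkinnerWan2017] §3.4 Lemma 3.4.1; [Castella2018Erratum] Lemma 2.1 (p. 2); [GreenbergVatsal2000] Prop. 2.4;
[Ochiai2006] Prop. 5.1; [Brink2007] Thm. 2, Cor. 1 (pp. 2134–2136); [Gross1991] §1; [SilvermanATAEC1994] Thm. V.5.3, Cor. V.5.4.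
-/

noncomputable section

-- D-0017: single-problem summit, the namespace repeats the problem name by design.
set_option linter.dupNamespace false
set_option autoImplicit false

open Field IsDedekindDomain NumberField WeierstrassCurve
open Literature.NumberTheory.GaloisRepresentations Literature.NumberTheory.EllipticCurves
  Literature.NumberTheory.EllipticCurves.BigRepModule Literature.NumberTheory.EllipticCurves.BigGaloisRep
open Summit.BirchSwinnertonDyer.Rank1Residual.X11b

namespace Summit.BirchSwinnertonDyer.BirchSwinnertonDyer.Theorems.TelescopeK2WeightTwoControlMapOfFiniteDefect

/-! ## §1 (hnd) for mixed control scalars -/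

/-- **(hnd), generically, for arbitrary factors**: if a ring map `π : 𝒪 → k` to a domain kills `c` but not `x`, and every factor
`F_i ∈ 𝒪⟦T⟧` stays non-zero after `PowerSeries.map π`, then `C c ∤ C x · ∏_i F_i` in `𝒪⟦T⟧`. (p752662's `not_C_dvd_C_mul_prod_aeval`
is the case `F_i = P_i((1+T)^{N_i})`, `N_i ≥ 1`, `P_i` monic.) [folklore] -/
theorem not_C_dvd_C_mul_prod_of_map_ne_zero {𝒪 : Type*} [CommRing 𝒪] {k : Type*} [CommRing k] [IsDomain k] (π : 𝒪 →+* k)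
    {c : 𝒪} (hc : π c = 0) {x : 𝒪} (hx : π x ≠ 0) {ι : Type*} (s : Finset ι) (F : ι → PowerSeries 𝒪)
    (hF : ∀ i ∈ s, PowerSeries.map π (F i) ≠ 0) :
    ¬ ((PowerSeries.C c : PowerSeries 𝒪) ∣ (PowerSeries.C x : PowerSeries 𝒪) * ∏ i ∈ s, F i) := by
  classical
  rintro ⟨g, hg⟩
  have h0 : PowerSeries.map π ((PowerSeries.C c : PowerSeries 𝒪) * g) = 0 := by
    rw [map_mul, PowerSeries.map_C, hc, map_zero, zero_mul]
  rw [← hg, map_mul, map_prod] at h0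
  rcases mul_eq_zero.1 h0 with h1 | h2
  · rw [PowerSeries.map_C] at h1
    exact hx (by simpa using congrArg PowerSeries.constantCoeff h1)
  · obtain ⟨i, hi, hzero⟩ := Finset.prod_eq_zero_iff.1 h2
    exact hF i hi hzero

/-- The Frobenius-data factor `P((1+T)^N)`, `N ≥ 1`, `P` monic, stays non-zero after reduction along `π` (p752662's
`aeval_one_add_X_pow_ne_zero` after `map_aeval_eq_aeval_map`). [folklore] -/
theorem map_aeval_one_add_X_pow_ne_zero {𝒪 : Type*} [CommRing 𝒪] {k : Type*} [CommRing k] [IsDomain k] (π : 𝒪 →+* k)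
    {N : ℕ} (hN : 0 < N) {P : Polynomial 𝒪} (hP : P.Monic) :
    PowerSeries.map π (Polynomial.aeval (((1 : PowerSeries 𝒪) + PowerSeries.X) ^ N) P) ≠ 0 := by
  rw [TelescopeK2WeightTwoControlMapOfFrobenius.map_aeval_eq_aeval_map, map_pow, map_add, map_one, PowerSeries.map_X]
  exact TelescopeK2WeightTwoControlMapOfFrobenius.aeval_one_add_X_pow_ne_zero hN (hP.map π)

/-- The degenerate factor: a constant `C y` with `π y ≠ 0` stays non-zero after reduction along `π`. [folklore] -/
theorem map_C_ne_zero {𝒪 : Type*} [CommRing 𝒪] {k : Type*} [CommRing k] (π : 𝒪 →+* k) {y : 𝒪} (hy : π y ≠ 0) :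
    PowerSeries.map π (PowerSeries.C y : PowerSeries 𝒪) ≠ 0 := by
  rw [PowerSeries.map_C]
  intro h
  exact hy (by simpa using congrArg PowerSeries.constantCoeff h)

/-- The degenerate Frobenius datum at a prime with finite inertia defect: the constant polynomial `C r` evaluated at ANY endomorphism
acts as `r`, and at `(1+T)^0` it is the constant power series `C r`. [folklore] -/
theorem aeval_C_apply {𝒪 : Type*} [CommRing 𝒪] {A : Type*} [AddCommGroup A] [Module 𝒪 A] (f : Module.End 𝒪 A) (r : 𝒪) (a : A) :
    (Polynomial.aeval f (Polynomial.C r)) a = r • a := by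
  rw [Polynomial.aeval_C, Module.algebraMap_end_apply]

/-! ## §2 W2's conclusion with `S₀` arbitrary: (deg₁)_w OR (fin_w) at each ramified `w ∤ p` -/

variable {K : Type} [Field K] [NumberField K] {p : ℕ} [Fact p.Prime]

/-- **SUB-LEAF W2 WITH `S₀` ARBITRARY — at each ramified `w ∤ p` EITHER degree one (finitely decomposed; Frobenius data as in p756867) OR the
finite inertia defect (fin_w).** `K` imaginary quadratic, `p ≠ 2`, `κ` anticyclotomic, `𝔭bar ∋ p` of degree one, `E = W/ℚ` multiplicative
at `p` (split or non-split), `ρ₂ : Γ_K → Aut_{ℤ_p⟦X⟧}(A₂)` with (tor), (cof₀), (unr `S₀`), (fd₀ `θ₀`, finite kernel); for every `w ∈ S₀` with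
`w ∤ p`: `e(w|ℚ) = f(w|ℚ) = 1` OR `∃ n, ∀ a ∈ A₂^{I_w}, ∃ a₀ ∈ A₂^{I_w}, X·a₀ = p^n·a`. Conclusion: W2's `∃ α` (kernel killed prime to
`C X`, finite cokernel). Proof = p756867's with the degenerate datum `(1, 0, C(p^n))` at the (fin)-primes and §1 for (hnd).
[cite: JetchevSkinnerWan2017, §3.4, Lemma 3.4.1 (arXiv:1512.06894 p. 14)] [cite: Castella2018Erratum, Lemma 2.1 (p. 2)]
[cite: SilvermanATAEC1994, Thm. V.5.3, Cor. V.5.4 (PDF pp. 407–410)] [cite: Brink2007, Thm. 2 and Cor. 1 (pp. 2134–2136)] -/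
theorem exists_weightTwoControlMap_of_mult_of_finiteDefect
    (W : WeierstrassCurve ℚ) [W.IsElliptic] (hK : IsImaginaryQuadratic K) (hp2 : p ≠ 2)
    (hmult : W.HasMultiplicativeReductionAtPrime p)
    (κ : ZpExtension K p) (hκ : κ.IsAnticyclotomic)
    (𝔭bar : HeightOneSpectrum (𝓞 K)) (h𝔭bar : ((p : ℕ) : 𝓞 K) ∈ 𝔭bar.asIdeal)
    (he : 𝔭bar.asIdeal.ramificationIdx (𝓞 ℚ) = 1) (hf : 𝔭bar.asIdeal.inertiaDeg (𝓞 ℚ) = 1)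
    [TopologicalSpace (PowerSeries ℤ_[p])] (A₂ : Type) [AddCommGroup A₂] [Module (PowerSeries ℤ_[p]) A₂]
    [TopologicalSpace A₂] [DiscreteTopology A₂]
    (ρ₂ : ContinuousRep (absoluteGaloisGroup K) (PowerSeries ℤ_[p]) A₂)
    [TopologicalSpace (PowerSeries (PowerSeries ℤ_[p]))]
    [ContinuousSMul (PowerSeries (PowerSeries ℤ_[p])) (BigRepModule (PowerSeries ℤ_[p]) p A₂)]
    -- (tor), (cof₀), (unr), (fd₀) of N1's fibre data
    (htor : ∀ a : A₂, ∃ n : ℕ, (PowerSeries.X : PowerSeries ℤ_[p]) ^ n • a = 0)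
    (hcof : ∀ a : A₂, ∃ b : A₂, (PowerSeries.X : PowerSeries ℤ_[p]) • b = a)
    (S₀ : Finset (HeightOneSpectrum (𝓞 K))) (hunr : GaloisRep.IsUnramifiedOutside (S₀ : Set (HeightOneSpectrum (𝓞 K))) ρ₂)
    (θ₀ : Submodule.torsionBy (PowerSeries ℤ_[p]) A₂ (PowerSeries.X : PowerSeries ℤ_[p]) →+
      PrimaryTorsion (W.baseChange K).geomPoints p)
    (hθσ : ∀ (σ : absoluteGaloisGroup K)
      (a : Submodule.torsionBy (PowerSeries ℤ_[p]) A₂ (PowerSeries.X : PowerSeries ℤ_[p])),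
      θ₀ (BigGaloisRep.torsionRep ρ₂ (PowerSeries.X : PowerSeries ℤ_[p]) σ a) =
        (W.baseChange K).primaryTorsionGaloisRep p σ (θ₀ a))
    (hker : Finite θ₀.ker)
    -- at each ramified `w ∤ p`: (deg₁)_w OR (fin_w)
    (hdegfin : ∀ w ∈ S₀, ((p : ℕ) : 𝓞 K) ∉ w.asIdeal →
      (w.asIdeal.ramificationIdx (𝓞 ℚ) = 1 ∧ w.asIdeal.inertiaDeg (𝓞 ℚ) = 1) ∨
      ∃ n : ℕ, ∀ a : A₂, (∀ h : LocalGroup K (Sum.inr w), ρ₂ (localMap K (Sum.inr w) h) a = a) →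
        ∃ a₀ : A₂, (∀ h : LocalGroup K (Sum.inr w), ρ₂ (localMap K (Sum.inr w) h) a₀ = a₀) ∧
          (PowerSeries.X : PowerSeries ℤ_[p]) • a₀ = ((p : PowerSeries ℤ_[p]) ^ n) • a) :
    ∃ α : QuotSMulTop (PowerSeries.C (PowerSeries.X : PowerSeries ℤ_[p])) (XBig κ ρ₂ 𝔭bar (∅ : Set (HeightOneSpectrum (𝓞 K))))
        →ₗ[PowerSeries (PowerSeries ℤ_[p])]
        CharacterModule (TorsionControl.selmer (localMap K) (strictSet p 𝔭bar (∅ : Set (HeightOneSpectrum (𝓞 K))))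
          (TorsionControl.torsionRep (AnticyclotomicBigGaloisRep κ ρ₂) (PowerSeries.C (PowerSeries.X : PowerSeries ℤ_[p])))),
      (∀ m ∈ LinearMap.ker α, ∃ s : PowerSeries (PowerSeries ℤ_[p]),
        ¬ ((PowerSeries.C (PowerSeries.X : PowerSeries ℤ_[p])) ∣ s) ∧ s • m = 0) ∧
      Finite ((CharacterModule (TorsionControl.selmer (localMap K) (strictSet p 𝔭bar (∅ : Set (HeightOneSpectrum (𝓞 K))))
        (TorsionControl.torsionRep (AnticyclotomicBigGaloisRep κ ρ₂) (PowerSeries.C (PowerSeries.X : PowerSeries ℤ_[p]))))) ⧸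
          LinearMap.range α) := by
  classical
  -- torsion and `p`-primarity of `A₂` from (tor) + (fd₀)
  have hPT : ∀ e : PrimaryTorsion (W.baseChange K).geomPoints p, IsOfFinAddOrder e := fun e => by
    obtain ⟨k, hk⟩ := PrimaryTorsion.exists_pow_smul_eq_zero e
    refine (isOfFinAddOrder_iff_nsmul_eq_zero).2 ⟨p ^ k, pow_pos (Nat.Prime.pos Fact.out) k, ?_⟩
    apply PrimaryTorsion.ext
    rw [PrimaryTorsion.val_nsmul, hk, PrimaryTorsion.val_zero]
  have htors : ∀ a : A₂, IsOfFinAddOrder a :=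
    TelescopeK2BigRepDivisible.isOfFinAddOrder_of_pow_torsion PowerSeries.X htor
      (TelescopeK2BigRepDivisible.isOfFinAddOrder_of_torsionBy PowerSeries.X θ₀ hker hPT)
  have hprim : ∀ a : A₂, ∃ k : ℕ, p ^ k • a = 0 := fun a =>
    TelescopeK2WeightTwoControlMapOfFrobenius.exists_pow_smul_eq_zero_of_isOfFinAddOrder (htors a)
  have hroot : ∀ a : A₂, (∃ k : ℕ, p ^ k • a = 0) →
      ∃ b : A₂, (∃ k : ℕ, p ^ k • b = 0) ∧ (PowerSeries.X : PowerSeries ℤ_[p]) • b = a :=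
    TelescopeK2BigRepDivisible.exists_primaryRoot_of_divisible PowerSeries.X hcof htors
  -- the open image at `𝔭bar` and the two finite fixed sets (MULTIPLICATIVE, split or non-split; (μ) at degree one)
  obtain ⟨s, hsurj⟩ :=
    AnticyclotomicLocalImage.anticyclotomic_exists_forall_exists_toAdd_eq_pow_mul hK hp2 κ hκ 𝔭bar h𝔭bar
  have hμ : ∀ ζ : AlgebraicClosure (𝔭bar.adicCompletion K),
      (∀ σ ∈ absInertia (𝔭bar.adicCompletion K), σ • ζ = ζ) → ζ ^ p = 1 → ζ = 1 := fun ζ hfix hζ =>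
    TelescopeK2InertiaMovesRootsOfUnity.eq_one_of_pow_prime_eq_one_of_forall_absInertia hp2 𝔭bar h𝔭bar he hf ζ hfix hζ
  have hfinloc := TelescopeK2FixedTorsionFiniteMult.finite_fixed_torsionBy_local_of_mult W κ ρ₂ PowerSeries.X θ₀
    hp2 hmult 𝔭bar h𝔭bar he hf hsurj hμ hθσ hker
  have hfinK := TelescopeK2FixedTorsionFiniteSplitMult.finite_fixed_torsionBy_global_of_local κ ρ₂ PowerSeries.X 𝔭bar hfinloc
  -- the Frobenius annihilators at EVERY `w ∤ p` ((ann), x2-p2 g20's p755753)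
  have hann := fun (w : HeightOneSpectrum (𝓞 K)) (hw : ((p : ℕ) : 𝓞 K) ∉ w.asIdeal) (d : LocalGroup K (Sum.inl w)) =>
    TelescopeK2InertiaFrobeniusAnnihilatorBranch.exists_monic_frobeniusAnnihilator_of_fibreData W A₂ ρ₂ htor hcof θ₀ hker w hw d
  -- the ramified primes away from `p`
  set S₁ : Finset (HeightOneSpectrum (𝓞 K)) := S₀.filter (fun w => ((p : ℕ) : 𝓞 K) ∉ w.asIdeal) with hS₁
  have hmem : ∀ w ∈ S₁, w ∈ S₀ ∧ ((p : ℕ) : 𝓞 K) ∉ w.asIdeal := fun w hw => Finset.mem_filter.1 hw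
  -- the (fin)-predicate at `w` (decided classically)
  let FinDef : HeightOneSpectrum (𝓞 K) → Prop := fun w =>
    ∃ n : ℕ, ∀ a : A₂, (∀ h : LocalGroup K (Sum.inr w), ρ₂ (localMap K (Sum.inr w) h) a = a) →
      ∃ a₀ : A₂, (∀ h : LocalGroup K (Sum.inr w), ρ₂ (localMap K (Sum.inr w) h) a₀ = a₀) ∧
        (PowerSeries.X : PowerSeries ℤ_[p]) • a₀ = ((p : PowerSeries ℤ_[p]) ^ n) • a
  -- at a non-(fin) prime of `S₁`, degree one gives `κ(d) = p^s` for some `d ∈ Γ_{K_w}`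
  have hd : ∀ w ∈ S₁, ¬ FinDef w → ∃ sd : ℕ × LocalGroup K (Sum.inl w),
      (κ (localMap K (Sum.inl w) sd.2)).toAdd = ((p ^ sd.1 : ℕ) : ℤ_[p]) := fun w hw hnf => by
    have hdeg : w.asIdeal.ramificationIdx (𝓞 ℚ) = 1 ∧ w.asIdeal.inertiaDeg (𝓞 ℚ) = 1 :=
      (hdegfin w (hmem w hw).1 (hmem w hw).2).resolve_right hnf
    obtain ⟨s', d, h⟩ := TelescopeK2WeightTwoControlMapOfFrobenius.exists_localMap_inl_toAdd_eq_pow hK κ hκ w (hmem w hw).2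
      hdeg.1 hdeg.2
    exact ⟨(s', d), h⟩
  let d₀ : ∀ w : HeightOneSpectrum (𝓞 K), LocalGroup K (Sum.inl w) := fun w =>
    if hw : w ∈ S₁ ∧ ¬ FinDef w then (Classical.choose (hd w hw.1 hw.2)).2 else 1
  let N : HeightOneSpectrum (𝓞 K) → ℕ := fun w =>
    if hw : w ∈ S₁ ∧ ¬ FinDef w then p ^ (Classical.choose (hd w hw.1 hw.2)).1 else 0
  have hN : ∀ w ∈ S₁, (κ (localMap K (Sum.inl w) (d₀ w))).toAdd = (N w : ℤ_[p]) := fun w hw => by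
    by_cases hF : FinDef w
    · have hc : ¬ (w ∈ S₁ ∧ ¬ FinDef w) := fun h => h.2 hF
      simp only [d₀, N, dif_neg hc, map_one, Nat.cast_zero]
      rfl
    · have hc : w ∈ S₁ ∧ ¬ FinDef w := ⟨hw, hF⟩
      simp only [d₀, N, dif_pos hc]
      exact Classical.choose_spec (hd w hw hF)
  -- the annihilating polynomials at the degree-one primes, the constants `C(p^n)` at the (fin)-primes
  have hPex : ∀ w ∈ S₁, ∃ P : Polynomial (PowerSeries ℤ_[p]), P.Monic ∧
      ∀ a : A₂, (∀ h : LocalGroup K (Sum.inr w), ρ₂ (localMap K (Sum.inr w) h) a = a) →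
        ∃ a₀ : A₂, (∀ h : LocalGroup K (Sum.inr w), ρ₂ (localMap K (Sum.inr w) h) a₀ = a₀) ∧
          (PowerSeries.X : PowerSeries ℤ_[p]) • a₀ = (Polynomial.aeval (ρ₂ (localMap K (Sum.inl w) (d₀ w))) P) a :=
    fun w hw => hann w (hmem w hw).2 (d₀ w)
  let P : HeightOneSpectrum (𝓞 K) → Polynomial (PowerSeries ℤ_[p]) := fun w =>
    if hF : FinDef w then Polynomial.C ((p : PowerSeries ℤ_[p]) ^ Classical.choose hF)
    else if hw : w ∈ S₁ then Classical.choose (hPex w hw) else Polynomial.X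
  have hP : ∀ w ∈ S₁, ∀ a : A₂, (∀ h : LocalGroup K (Sum.inr w), ρ₂ (localMap K (Sum.inr w) h) a = a) →
      ∃ a₀ : A₂, (∀ h : LocalGroup K (Sum.inr w), ρ₂ (localMap K (Sum.inr w) h) a₀ = a₀) ∧
        (PowerSeries.X : PowerSeries ℤ_[p]) • a₀ = (Polynomial.aeval (ρ₂ (localMap K (Sum.inl w) (d₀ w))) (P w)) a :=
    fun w hw a ha => by
    by_cases hF : FinDef w
    · obtain ⟨a₀, ha₀, h⟩ := Classical.choose_spec hF a ha
      refine ⟨a₀, ha₀, ?_⟩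
      simp only [P, dif_pos hF]
      rw [aeval_C_apply]
      exact h
    · simp only [P, dif_neg hF, dif_pos hw]
      exact (Classical.choose_spec (hPex w hw)).2 a ha
  refine TelescopeK2ControlOfFrobeniusData.exists_quotSMulTop_XBig_linearMap_of_frobeniusData κ ρ₂ 𝔭bar ∅
    PowerSeries.X (fun a _ => htor a) hroot hfinK hsurj hfinloc S₁ ?_ d₀ N hN P hP ?_ ?_
  · -- (hunr) off `S₁`: a strict-set index `Sum.inr w` has `w ∤ p`, so `w ∉ S₁ ⇒ w ∉ S₀ ⇒` unramified
    intro w hw hstrict τ a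
    have hpw : ((p : ℕ) : 𝓞 K) ∉ w.asIdeal := ((inr_mem_strictSet_iff p 𝔭bar w (∅ : Set (HeightOneSpectrum (𝓞 K)))).1 hstrict).2
    have hwS₀ : w ∉ (S₀ : Set (HeightOneSpectrum (𝓞 K))) := fun h =>
      hw (Finset.mem_filter.2 ⟨Finset.mem_coe.1 h, hpw⟩)
    exact TelescopeK2WeightTwoControlMapOfInert.apply_localMap_inr_eq_self_of_isUnramifiedAt ρ₂ (hunr w hwS₀) τ a
  · -- (hrootsI): every element of `A₂` is `p`-primary
    rintro w - a - - ⟨a₀, ha₀, hc⟩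
    exact ⟨a₀, ha₀, hprim a₀, hc⟩
  · -- (hnd): reduce modulo `X` (`constantCoeff : ℤ_p⟦X⟧ → ℤ_p`), §1; the factors stay non-zero modulo `X`
    intro a
    refine not_C_dvd_C_mul_prod_of_map_ne_zero (PowerSeries.constantCoeff (R := ℤ_[p])) PowerSeries.constantCoeff_X ?_ S₁ _ ?_
    · rw [map_pow, map_natCast]
      exact pow_ne_zero _ (Nat.cast_ne_zero.2 (Nat.Prime.ne_zero Fact.out))
    · intro w hw
      by_cases hF : FinDef w
      · have hc : ¬ (w ∈ S₁ ∧ ¬ FinDef w) := fun h => h.2 hF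
        simp only [P, N, dif_pos hF, dif_neg hc, Polynomial.aeval_C]
        rw [PowerSeries.algebraMap_apply, Algebra.algebraMap_self, RingHom.id_apply]
        refine map_C_ne_zero _ ?_
        rw [map_pow, map_natCast]
        exact pow_ne_zero _ (Nat.cast_ne_zero.2 (Nat.Prime.ne_zero Fact.out))
      · have hc : w ∈ S₁ ∧ ¬ FinDef w := ⟨hw, hF⟩
        have hNpos : 0 < N w := by
          simp only [N, dif_pos hc]
          exact pow_pos (Nat.Prime.pos Fact.out) _
        have hPmon : (P w).Monic := by
          simp only [P, dif_neg hF, dif_pos hw]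
          exact (Classical.choose_spec (hPex w hw)).1
        exact map_aeval_one_add_X_pow_ne_zero _ hNpos hPmon

/-- **SUB-LEAF W2 FROM (fin) ALONE — no Heegner hypothesis, no degree-one primes, no annihilating polynomial**: if at EVERY ramified
`w ∤ p` the inertia defect `A₂^{I_w}/X·A₂^{I_w}` is killed by a power of `p`, W2's `∃ α` holds (the control scalar is a power of `p`).
[cite: JetchevSkinnerWan2017, §3.4, Lemma 3.4.1 (arXiv:1512.06894 p. 14)] [cite: Castella2018Erratum, Lemma 2.1 (p. 2)]
[cite: SilvermanATAEC1994, Thm. V.5.3, Cor. V.5.4 (PDF pp. 407–410)] -/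
theorem exists_weightTwoControlMap_of_finiteDefect
    (W : WeierstrassCurve ℚ) [W.IsElliptic] (hK : IsImaginaryQuadratic K) (hp2 : p ≠ 2)
    (hmult : W.HasMultiplicativeReductionAtPrime p)
    (κ : ZpExtension K p) (hκ : κ.IsAnticyclotomic)
    (𝔭bar : HeightOneSpectrum (𝓞 K)) (h𝔭bar : ((p : ℕ) : 𝓞 K) ∈ 𝔭bar.asIdeal)
    (he : 𝔭bar.asIdeal.ramificationIdx (𝓞 ℚ) = 1) (hf : 𝔭bar.asIdeal.inertiaDeg (𝓞 ℚ) = 1)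
    [TopologicalSpace (PowerSeries ℤ_[p])] (A₂ : Type) [AddCommGroup A₂] [Module (PowerSeries ℤ_[p]) A₂]
    [TopologicalSpace A₂] [DiscreteTopology A₂]
    (ρ₂ : ContinuousRep (absoluteGaloisGroup K) (PowerSeries ℤ_[p]) A₂)
    [TopologicalSpace (PowerSeries (PowerSeries ℤ_[p]))]
    [ContinuousSMul (PowerSeries (PowerSeries ℤ_[p])) (BigRepModule (PowerSeries ℤ_[p]) p A₂)]
    (htor : ∀ a : A₂, ∃ n : ℕ, (PowerSeries.X : PowerSeries ℤ_[p]) ^ n • a = 0)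
    (hcof : ∀ a : A₂, ∃ b : A₂, (PowerSeries.X : PowerSeries ℤ_[p]) • b = a)
    (S₀ : Finset (HeightOneSpectrum (𝓞 K))) (hunr : GaloisRep.IsUnramifiedOutside (S₀ : Set (HeightOneSpectrum (𝓞 K))) ρ₂)
    (θ₀ : Submodule.torsionBy (PowerSeries ℤ_[p]) A₂ (PowerSeries.X : PowerSeries ℤ_[p]) →+
      PrimaryTorsion (W.baseChange K).geomPoints p)
    (hθσ : ∀ (σ : absoluteGaloisGroup K)
      (a : Submodule.torsionBy (PowerSeries ℤ_[p]) A₂ (PowerSeries.X : PowerSeries ℤ_[p])),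
      θ₀ (BigGaloisRep.torsionRep ρ₂ (PowerSeries.X : PowerSeries ℤ_[p]) σ a) =
        (W.baseChange K).primaryTorsionGaloisRep p σ (θ₀ a))
    (hker : Finite θ₀.ker)
    (hfin : ∀ w ∈ S₀, ((p : ℕ) : 𝓞 K) ∉ w.asIdeal →
      ∃ n : ℕ, ∀ a : A₂, (∀ h : LocalGroup K (Sum.inr w), ρ₂ (localMap K (Sum.inr w) h) a = a) →
        ∃ a₀ : A₂, (∀ h : LocalGroup K (Sum.inr w), ρ₂ (localMap K (Sum.inr w) h) a₀ = a₀) ∧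
          (PowerSeries.X : PowerSeries ℤ_[p]) • a₀ = ((p : PowerSeries ℤ_[p]) ^ n) • a) :
    ∃ α : QuotSMulTop (PowerSeries.C (PowerSeries.X : PowerSeries ℤ_[p])) (XBig κ ρ₂ 𝔭bar (∅ : Set (HeightOneSpectrum (𝓞 K))))
        →ₗ[PowerSeries (PowerSeries ℤ_[p])]
        CharacterModule (TorsionControl.selmer (localMap K) (strictSet p 𝔭bar (∅ : Set (HeightOneSpectrum (𝓞 K))))
          (TorsionControl.torsionRep (AnticyclotomicBigGaloisRep κ ρ₂) (PowerSeries.C (PowerSeries.X : PowerSeries ℤ_[p])))),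
      (∀ m ∈ LinearMap.ker α, ∃ s : PowerSeries (PowerSeries ℤ_[p]),
        ¬ ((PowerSeries.C (PowerSeries.X : PowerSeries ℤ_[p])) ∣ s) ∧ s • m = 0) ∧
      Finite ((CharacterModule (TorsionControl.selmer (localMap K) (strictSet p 𝔭bar (∅ : Set (HeightOneSpectrum (𝓞 K))))
        (TorsionControl.torsionRep (AnticyclotomicBigGaloisRep κ ρ₂) (PowerSeries.C (PowerSeries.X : PowerSeries ℤ_[p]))))) ⧸
          LinearMap.range α) :=
  exists_weightTwoControlMap_of_mult_of_finiteDefect W hK hp2 hmult κ hκ 𝔭bar h𝔭bar he hf A₂ ρ₂ htor hcof S₀ hunr θ₀ hθσ hker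
    (fun w hw hpw => Or.inr (hfin w hw hpw))

/-! ## §3 The road-prefix currency of the N2 workfile: the residual of road (b) as a named per-prime hypothesis -/

/-- **SUB-LEAF W2 IN THE ROAD-PREFIX CURRENCY OF THE N2 WORKFILE, `S₀` ARBITRARY** (`K2Weight2.stub_weightTwoControlMap`, telescope
v10): from `CellC W p`, `K` imaginary quadratic satisfying the Heegner hypothesis for `N`, `p` split in `K`, `κ` anticyclotomic, `𝔭bar ∋ p`,
N1's fibre data (tor)/(cof₀)/(unr `S₀`, ANY finite set)/(fd₀), PLUS the residual (fin_w) at the `w ∈ S₀` with `w ∤ p`, `w ∤ N` ONLY: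
W2's conclusion. With «`S₀ ∖ {w ∣ p} ⊆ {w ∣ N}`» the last hypothesis is vacuous and this is p756867's `exists_weightTwoControlMap_of_cellC`.
[cite: JetchevSkinnerWan2017, §3.4, Lemma 3.4.1 (arXiv:1512.06894 p. 14)] [cite: Castella2018Erratum, Lemma 2.1 (p. 2)]
[cite: SilvermanATAEC1994, Thm. V.5.3, Cor. V.5.4] [cite: Gross1991, §1] [cite: Brink2007, Cor. 1] -/
theorem exists_weightTwoControlMap_of_cellC_of_finiteDefect
    (W : WeierstrassCurve ℚ) [W.IsElliptic] [W.IsGloballyMinimal] (hc : Rank1Residual.X2.CellC W p)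
    {N : ℕ} [NeZero N] (hK : IsImaginaryQuadratic K) (hHeeg : SatisfiesHeegnerHypothesis N K)
    (hsp : ((Ideal.span {(p : ℤ)}).primesOver (𝓞 K)).ncard = 2)
    (κ : ZpExtension K p) (hκ : κ.IsAnticyclotomic)
    (𝔭bar : HeightOneSpectrum (𝓞 K)) (h𝔭bar : ((p : ℕ) : 𝓞 K) ∈ 𝔭bar.asIdeal)
    [TopologicalSpace (PowerSeries ℤ_[p])] (A₂ : Type) [AddCommGroup A₂] [Module (PowerSeries ℤ_[p]) A₂]
    [TopologicalSpace A₂] [DiscreteTopology A₂]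
    (ρ₂ : ContinuousRep (absoluteGaloisGroup K) (PowerSeries ℤ_[p]) A₂)
    [TopologicalSpace (PowerSeries (PowerSeries ℤ_[p]))]
    [ContinuousSMul (PowerSeries (PowerSeries ℤ_[p])) (BigRepModule (PowerSeries ℤ_[p]) p A₂)]
    (htor : ∀ a : A₂, ∃ n : ℕ, (PowerSeries.X : PowerSeries ℤ_[p]) ^ n • a = 0)
    (hcof : ∀ a : A₂, ∃ b : A₂, (PowerSeries.X : PowerSeries ℤ_[p]) • b = a)
    (S₀ : Set (HeightOneSpectrum (𝓞 K))) (hS₀ : S₀.Finite) (hunr : GaloisRep.IsUnramifiedOutside S₀ ρ₂)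
    (θ₀ : Submodule.torsionBy (PowerSeries ℤ_[p]) A₂ (PowerSeries.X : PowerSeries ℤ_[p]) →+
      PrimaryTorsion (W.baseChange K).geomPoints p)
    (hθσ : ∀ (σ : absoluteGaloisGroup K)
      (a : Submodule.torsionBy (PowerSeries ℤ_[p]) A₂ (PowerSeries.X : PowerSeries ℤ_[p])),
      θ₀ (BigGaloisRep.torsionRep ρ₂ (PowerSeries.X : PowerSeries ℤ_[p]) σ a) =
        (W.baseChange K).primaryTorsionGaloisRep p σ (θ₀ a))
    (hker : Finite θ₀.ker)
    -- the residual of road (b): (fin_w) at the ramified primes away from `N·p`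
    (hfin : ∀ w ∈ S₀, ((p : ℕ) : 𝓞 K) ∉ w.asIdeal → ((N : ℕ) : 𝓞 K) ∉ w.asIdeal →
      ∃ n : ℕ, ∀ a : A₂, (∀ h : LocalGroup K (Sum.inr w), ρ₂ (localMap K (Sum.inr w) h) a = a) →
        ∃ a₀ : A₂, (∀ h : LocalGroup K (Sum.inr w), ρ₂ (localMap K (Sum.inr w) h) a₀ = a₀) ∧
          (PowerSeries.X : PowerSeries ℤ_[p]) • a₀ = ((p : PowerSeries ℤ_[p]) ^ n) • a) :
    ∃ α : QuotSMulTop (PowerSeries.C (PowerSeries.X : PowerSeries ℤ_[p])) (XBig κ ρ₂ 𝔭bar (∅ : Set (HeightOneSpectrum (𝓞 K))))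
        →ₗ[PowerSeries (PowerSeries ℤ_[p])]
        CharacterModule (TorsionControl.selmer (localMap K) (strictSet p 𝔭bar (∅ : Set (HeightOneSpectrum (𝓞 K))))
          (TorsionControl.torsionRep (AnticyclotomicBigGaloisRep κ ρ₂) (PowerSeries.C (PowerSeries.X : PowerSeries ℤ_[p])))),
      (∀ m ∈ LinearMap.ker α, ∃ s : PowerSeries (PowerSeries ℤ_[p]),
        ¬ ((PowerSeries.C (PowerSeries.X : PowerSeries ℤ_[p])) ∣ s) ∧ s • m = 0) ∧
      Finite ((CharacterModule (TorsionControl.selmer (localMap K) (strictSet p 𝔭bar (∅ : Set (HeightOneSpectrum (𝓞 K))))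
        (TorsionControl.torsionRep (AnticyclotomicBigGaloisRep κ ρ₂) (PowerSeries.C (PowerSeries.X : PowerSeries ℤ_[p]))))) ⧸
          LinearMap.range α) := by
  classical
  -- `CellC = (r_an = 1) ∧ (p ≠ 2 ∧ Red ∧ Mult)`; `𝔭bar` has degree one because `p` splits in the quadratic field `K`
  have hp2 : p ≠ 2 := hc.2.1
  have hmult : W.HasMultiplicativeReductionAtPrime p := hc.2.2.2
  obtain ⟨he, hf⟩ := degreeOne_of_splitsIn hK.1 hsp h𝔭bar
  have hcoe : ((hS₀.toFinset : Finset (HeightOneSpectrum (𝓞 K))) : Set (HeightOneSpectrum (𝓞 K))) = S₀ := hS₀.coe_toFinset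
  refine exists_weightTwoControlMap_of_mult_of_finiteDefect W hK hp2 hmult κ hκ 𝔭bar h𝔭bar he hf A₂ ρ₂ htor hcof hS₀.toFinset
    (by rw [hcoe]; exact hunr) θ₀ hθσ hker (fun w hw hpw => ?_)
  by_cases hNw : ((N : ℕ) : 𝓞 K) ∈ w.asIdeal
  · exact Or.inl (ramificationIdx_eq_one_and_inertiaDeg_eq_one_of_natCast_mem_of_satisfiesHeegnerHypothesis hK.1 hHeeg
      (NeZero.ne N) w hNw)
  · exact Or.inr (hfin w (hS₀.mem_toFinset.1 hw) hpw hNw)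

end Summit.BirchSwinnertonDyer.BirchSwinnertonDyer.Theorems.TelescopeK2WeightTwoControlMapOfFiniteDefect

end
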